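/- Fleet lead `ym-wcr-19456-p1`, route `WeakCouplingRates`, crux `ColdBoxTwoPointFloor` (stmt-QuantumFields-19456). -/
import Summits.QuantumFields.YangMills.Theorems.WeakCouplingRatesColdBoxDirichletPosDef
import Literature.Probability.Distributions.MultivariateGaussianWick

/-!
# Crux `ColdBoxTwoPointFloor`: the circulation process of a pinned lattice-Maxwell Gaussian (general), and the
# Dirichlet Gaussian of the cold-wall box — centred Gaussian process, two-point = `λ·Q⁻¹λ`, Wick for squares

General form (any dimension `d`, any decidable pinned predicate `pin`, corner `a`, side `n`) of the Gaussian structure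
lemmas of the S3a file `…StubBoxGaussianWick` for Chatterjee's `LatticeMaxwell.τ pin a n = N(0, Q⁻¹)`:
`isGaussianProcess_sCirc_glue` (the circulations `s ↦ s(p)` of the glued free field form a Gaussian process),
`integral_sCirc_glue` (centred), `integral_sCirc_glue_mul` (for positive definite `Q`: `E[s(p)s(q)] = λ_p·Q⁻¹λ_q`),
`integral_sCirc_glue_sq_mul_sq_sub` (Wick/Isserlis: `Cov(s(p)², s(q)²) = 2E[s(p)s(q)]²`).  Instance for the temporal-gauge
DIRICHLET Gaussian `boxDirichlet H` of the cold-wall box (D1', non-degenerate by `posDef_dirQmat`):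
`isGaussianProcess_dirCirc`, `integral_dirCirc`, `integral_dirCirc_mul`, `boxDirichletPlaqCov_eq_dotProduct`
(`Π^D_H(T)` is a matrix element of `Q_D⁻¹`), `dirCirc_sq_cov_eq` (`Cov_D(s(p_c)², s(p_c+Te₀)²) = 2·Π^D_H(T)²` — the leading
term, per colour component and up to `¼`, of `β²·boxPlaqCov` in piece S3c-ii of stub `stub_boxGaussianDomination`).
References: Isserlis 1918 / Janson 1997 Thm 1.28 (tree `GaussianWick.integral_prod_four`); Chatterjee arXiv:1602.01222 §13.
Everything proved; no definition, no named fact; standard axioms.  NOT a statement about the mass gap.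
-/

set_option autoImplicit false

noncomputable section

open MeasureTheory ProbabilityTheory Matrix
open Literature.MathematicalPhysics.QuantumFieldTheory
open Literature.MathematicalPhysics.QuantumFieldTheory.LatticeMaxwell
open Literature.MathematicalPhysics.QuantumFieldTheory.AxialGauge

namespace Summit.QuantumFields.YangMills.Theorems.WeakCouplingRates

section General

variable {d : ℕ} {pin : Literature.MathematicalPhysics.QuantumLattice.ZdEdge d → Prop} [DecidablePred pin]
  {a : Literature.Probability.LatticeModels.Site d} {n : ℕ}

/-- The circulation is linear in the free variables: `s(p) = λ_p · s`. -/
theorem sCirc_glue_zero_eq_dotProduct (p : Plaq d) (s : EuclideanSpace ℝ (Free pin a n)) :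
    sCirc (glue (pin := pin) a n 0 (WithLp.ofLp s)) p = coeff pin a n p ⬝ᵥ WithLp.ofLp s := by
  rw [sCirc_glue, bterm]
  have : sCirc (glue (pin := pin) a n (0 : Literature.MathematicalPhysics.QuantumLattice.ZdEdge d → ℝ)
      (0 : Free pin a n → ℝ)) p = 0 := by
    simp [sCirc, glue_zero_eq_sum]
  rw [this, add_zero]

/-- `s(p) = Σ_e λ_p(e) s_e`. -/
theorem sCirc_glue_zero_eq_sum (p : Plaq d) (s : EuclideanSpace ℝ (Free pin a n)) :
    sCirc (glue (pin := pin) a n 0 (WithLp.ofLp s)) p = ∑ e : Free pin a n, coeff pin a n p e * s e := by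
  rw [sCirc_glue_zero_eq_dotProduct]; rfl

variable (pin a n) in
/-- The coordinate process of `τ pin a n` is a Gaussian process. -/
theorem isGaussianProcess_eval_τ :
    IsGaussianProcess (fun (e : Free pin a n) (s : EuclideanSpace ℝ (Free pin a n)) => s e) (τ pin a n) :=
  Literature.Probability.LatticeModels.isGaussianProcess_eval_multivariateGaussian _ _

variable (pin a n) in
/-- **The circulation process `p ↦ s(p)` is a Gaussian process** under `τ pin a n`. -/
theorem isGaussianProcess_sCirc_glue : IsGaussianProcess (fun (p : Plaq d) (s : EuclideanSpace ℝ (Free pin a n)) =>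
      sCirc (glue (pin := pin) a n 0 (WithLp.ofLp s)) p) (τ pin a n) := by
  classical
  refine (isGaussianProcess_eval_τ pin a n).of_isGaussianProcess fun p => ?_
  refine ⟨Finset.univ, ∑ e : Free pin a n,
    coeff pin a n p e •
      ContinuousLinearMap.proj (R := ℝ) (φ := fun _ : ↥(Finset.univ : Finset (Free pin a n)) => ℝ)
        ⟨e, Finset.mem_univ e⟩, fun s => ?_⟩
  simp only [sCirc_glue_zero_eq_sum]
  simp [Finset.restrict_def]

/-- Coordinates are integrable under `τ pin a n`. -/
theorem integrable_eval_τ (e : Free pin a n) :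
    Integrable (fun s : EuclideanSpace ℝ (Free pin a n) => s e) (τ pin a n) :=
  ((isGaussianProcess_eval_τ pin a n).hasGaussianLaw_eval e).memLp_two.integrable one_le_two

/-- Products of two coordinates are integrable under `τ pin a n`. -/
theorem integrable_eval_mul_eval_τ (e f : Free pin a n) :
    Integrable (fun s : EuclideanSpace ℝ (Free pin a n) => s e * s f) (τ pin a n) :=
  ((isGaussianProcess_eval_τ pin a n).hasGaussianLaw_eval e).memLp_two.integrable_mul
    ((isGaussianProcess_eval_τ pin a n).hasGaussianLaw_eval f).memLp_two

/-- **The circulations are centred.** -/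
theorem integral_sCirc_glue (p : Plaq d) :
    ∫ s, sCirc (glue (pin := pin) a n 0 (WithLp.ofLp s)) p ∂(τ pin a n) = 0 := by
  simp_rw [sCirc_glue_zero_eq_sum]
  rw [integral_finsetSum _ fun e _ => (integrable_eval_τ e).const_mul _]
  refine Finset.sum_eq_zero fun e _ => ?_
  rw [integral_const_mul]
  erw [Literature.Probability.Distributions.GaussianWick.integral_eval_multivariateGaussian_zero]
  rw [mul_zero]

/-- **Two-point function = bilinear form of `Q⁻¹`** (for positive definite precision matrix `Q`):
`E[s(p) s(q)] = λ_p · Q⁻¹ λ_q`. -/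
theorem integral_sCirc_glue_mul (hQ : (Qmat pin a n).PosDef) (p q : Plaq d) :
    ∫ s, sCirc (glue (pin := pin) a n 0 (WithLp.ofLp s)) p * sCirc (glue (pin := pin) a n 0 (WithLp.ofLp s)) q ∂(τ pin a n) =
      coeff pin a n p ⬝ᵥ (Qmat pin a n)⁻¹ *ᵥ coeff pin a n q := by
  classical
  set cp := coeff pin a n p with hcp
  set cq := coeff pin a n q with hcq
  set S := (Qmat pin a n)⁻¹ with hS
  have hint : ∀ s : EuclideanSpace ℝ (Free pin a n),
      sCirc (glue (pin := pin) a n 0 (WithLp.ofLp s)) p * sCirc (glue (pin := pin) a n 0 (WithLp.ofLp s)) q =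
      ∑ e, ∑ f, cp e * cq f * (s e * s f) := fun s => by
    rw [sCirc_glue_zero_eq_sum, sCirc_glue_zero_eq_sum, Finset.sum_mul_sum]
    refine Finset.sum_congr rfl fun e _ => Finset.sum_congr rfl fun f _ => ?_
    ring
  simp_rw [hint]
  rw [integral_finsetSum _ fun e _ => integrable_finsetSum _ fun f _ =>
    (integrable_eval_mul_eval_τ e f).const_mul _]
  simp_rw [integral_finsetSum _ fun f _ => (integrable_eval_mul_eval_τ _ f).const_mul _,
    integral_const_mul]
  have h2 : ∀ e f : Free pin a n, ∫ s : EuclideanSpace ℝ (Free pin a n), s e * s f ∂(τ pin a n) = S e f :=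
    fun e f => Literature.Probability.Distributions.GaussianWick.integral_eval_mul_eval_multivariateGaussian
      hQ.inv.posSemidef e f
  simp_rw [h2]
  simp only [dotProduct, mulVec, Finset.mul_sum]
  refine Finset.sum_congr rfl fun e _ => Finset.sum_congr rfl fun f _ => ?_
  ring

/-- **Wick / Isserlis for the squared circulations**: `Cov(s(p)², s(q)²) = 2 · E[s(p)s(q)]²`. -/
theorem integral_sCirc_glue_sq_mul_sq_sub (p q : Plaq d) :
    (∫ s, sCirc (glue (pin := pin) a n 0 (WithLp.ofLp s)) p ^ 2 *
        sCirc (glue (pin := pin) a n 0 (WithLp.ofLp s)) q ^ 2 ∂(τ pin a n)) -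
        (∫ s, sCirc (glue (pin := pin) a n 0 (WithLp.ofLp s)) p ^ 2 ∂(τ pin a n)) *
          (∫ s, sCirc (glue (pin := pin) a n 0 (WithLp.ofLp s)) q ^ 2 ∂(τ pin a n)) =
      2 * (∫ s, sCirc (glue (pin := pin) a n 0 (WithLp.ofLp s)) p *
        sCirc (glue (pin := pin) a n 0 (WithLp.ofLp s)) q ∂(τ pin a n)) ^ 2 := by
  have h4 := Literature.Probability.Distributions.GaussianWick.integral_prod_four
    (isGaussianProcess_sCirc_glue pin a n) integral_sCirc_glue ![p, p, q, q]
  simp only [Matrix.cons_val_zero, Matrix.cons_val_one] at h4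
  have e2 : (![p, p, q, q] : Fin 4 → Plaq d) 2 = q := rfl
  have e3 : (![p, p, q, q] : Fin 4 → Plaq d) 3 = q := rfl
  rw [e2, e3] at h4
  have hl : ∀ s : EuclideanSpace ℝ (Free pin a n),
      sCirc (glue (pin := pin) a n 0 (WithLp.ofLp s)) p ^ 2 * sCirc (glue (pin := pin) a n 0 (WithLp.ofLp s)) q ^ 2 =
        sCirc (glue (pin := pin) a n 0 (WithLp.ofLp s)) p * sCirc (glue (pin := pin) a n 0 (WithLp.ofLp s)) p *
          sCirc (glue (pin := pin) a n 0 (WithLp.ofLp s)) q * sCirc (glue (pin := pin) a n 0 (WithLp.ofLp s)) q :=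
    fun s => by ring
  have hp2 : ∀ s : EuclideanSpace ℝ (Free pin a n), sCirc (glue (pin := pin) a n 0 (WithLp.ofLp s)) p ^ 2 =
      sCirc (glue (pin := pin) a n 0 (WithLp.ofLp s)) p * sCirc (glue (pin := pin) a n 0 (WithLp.ofLp s)) p :=
    fun s => by ring
  have hq2 : ∀ s : EuclideanSpace ℝ (Free pin a n), sCirc (glue (pin := pin) a n 0 (WithLp.ofLp s)) q ^ 2 =
      sCirc (glue (pin := pin) a n 0 (WithLp.ofLp s)) q * sCirc (glue (pin := pin) a n 0 (WithLp.ofLp s)) q :=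
    fun s => by ring
  simp_rw [hl, hp2, hq2, h4]
  ring

end General

/-! ## Instance: the Dirichlet Gaussian `boxDirichlet H` of the cold-wall box (D1') -/

section Dirichlet

variable {H : ℕ}

/-- The Dirichlet circulation process `p ↦ s(p)` is a Gaussian process under `boxDirichlet H`. -/
theorem isGaussianProcess_dirCirc (H : ℕ) : IsGaussianProcess (dirCirc H) (boxDirichlet H) :=
  isGaussianProcess_sCirc_glue _ _ _

/-- The Dirichlet circulations are centred. -/
theorem integral_dirCirc (p : Plaq 4) : ∫ s, dirCirc H p s ∂(boxDirichlet H) = 0 :=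
  integral_sCirc_glue p

/-- **Two-point function of the Dirichlet circulations** = bilinear form of `Q_D⁻¹` (positive definite by
`posDef_dirQmat`): `E_D[s(p) s(q)] = λ_p · Q_D⁻¹ λ_q`. -/
theorem integral_dirCirc_mul (p q : Plaq 4) :
    ∫ s, dirCirc H p s * dirCirc H q s ∂(boxDirichlet H) =
      coeff (fun e => e ∉ dirFreeEdges H) dirCorner (2 * H + 3) p ⬝ᵥ
        (Qmat (fun e => e ∉ dirFreeEdges H) dirCorner (2 * H + 3))⁻¹ *ᵥ
        coeff (fun e => e ∉ dirFreeEdges H) dirCorner (2 * H + 3) q :=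
  integral_sCirc_glue_mul (posDef_dirQmat H) p q

/-- **D1' is a matrix element of `Q_D⁻¹`**: `boxDirichletPlaqCov H T = λ_{p_c} · Q_D⁻¹ λ_{p_c + T e₀}`. -/
theorem boxDirichletPlaqCov_eq_dotProduct (H T : ℕ) :
    boxDirichletPlaqCov H T =
      coeff (fun e => e ∉ dirFreeEdges H) dirCorner (2 * H + 3) (plaq12At (boxCentre H)) ⬝ᵥ
        (Qmat (fun e => e ∉ dirFreeEdges H) dirCorner (2 * H + 3))⁻¹ *ᵥ
        coeff (fun e => e ∉ dirFreeEdges H) dirCorner (2 * H + 3) (plaq12At (boxCentre H + Pi.single 0 (T : ℤ))) :=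
  integral_dirCirc_mul _ _

/-- **Wick for the Dirichlet Gaussian**: for every two plaquettes,
`E_D[s(p)²s(q)²] − E_D[s(p)²]E_D[s(q)²] = 2·E_D[s(p)s(q)]²`. -/
theorem integral_dirCirc_sq_mul_sq_sub (p q : Plaq 4) :
    (∫ s, dirCirc H p s ^ 2 * dirCirc H q s ^ 2 ∂(boxDirichlet H)) -
        (∫ s, dirCirc H p s ^ 2 ∂(boxDirichlet H)) * (∫ s, dirCirc H q s ^ 2 ∂(boxDirichlet H)) =
      2 * (∫ s, dirCirc H p s * dirCirc H q s ∂(boxDirichlet H)) ^ 2 :=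
  integral_sCirc_glue_sq_mul_sq_sub p q

/-- **The Dirichlet Gaussian floor in Wick form**: the connected two-point function of the squared Dirichlet
circulations of the two plaquettes of D1/D1' equals `2 · boxDirichletPlaqCov H T ²` — the leading term (per colour
component, up to `¼`) of `β² · boxPlaqCov` in the cold-wall box. -/
theorem dirCirc_sq_cov_eq (H T : ℕ) :
    (∫ s, dirCirc H (plaq12At (boxCentre H)) s ^ 2 *
          dirCirc H (plaq12At (boxCentre H + Pi.single 0 (T : ℤ))) s ^ 2 ∂(boxDirichlet H)) -
        (∫ s, dirCirc H (plaq12At (boxCentre H)) s ^ 2 ∂(boxDirichlet H)) *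
          (∫ s, dirCirc H (plaq12At (boxCentre H + Pi.single 0 (T : ℤ))) s ^ 2 ∂(boxDirichlet H)) =
      2 * boxDirichletPlaqCov H T ^ 2 :=
  integral_dirCirc_sq_mul_sq_sub _ _

/-- **Dirichlet Wick in the named form**: `boxDirCircSqCov H T = 2 · boxDirichletPlaqCov H T ²` (the Dirichlet analogue of
the landed S3a `stub_boxGaussianWick`; used by the v5 composition S3 ⇐ S3c-ii ∧ S3c-iii of the birth skeleton). -/
theorem boxDirCircSqCov_eq_two_mul_sq (H T : ℕ) : boxDirCircSqCov H T = 2 * boxDirichletPlaqCov H T ^ 2 := by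
  rw [boxDirCircSqCov]; exact dirCirc_sq_cov_eq H T

/-- In particular `0 ≤ boxDirCircSqCov H T`. -/
theorem boxDirCircSqCov_nonneg (H T : ℕ) : 0 ≤ boxDirCircSqCov H T := by
  rw [boxDirCircSqCov_eq_two_mul_sq]; positivity

end Dirichlet

end Summit.QuantumFields.YangMills.Theorems.WeakCouplingRates

end
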